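import Summits.SmoothPoincare4.SmoothPoincare4.Theses.SullivanDual
import Literature.Geometry.Symplectic.GromovMcDuffChartFormRelEnd
import Literature.Geometry.Symplectic.GromovMcDuffChartFormIff
import HarnessLib

/-!
# SmoothPoincare4 / SullivanDual — the support item `GromovChartForm` (stmt-SmoothPoincare4-11129)

The route item `Summit.SmoothPoincare4.SmoothPoincare4.Theses.SullivanDual.GromovChartForm`
(hypothesis `hG` of the deciding theorem `closes` of route SullivanDual) is the Gromov–McDuff
CHART FORM for punctured homotopy 4-spheres: *if a `2`-form `sf` on `Σ ∖ {p}` is symplectic and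
standard near `p` (`IsSymplecticStandardNearPoint p ε sf`), then there is a diffeomorphism
`Φ : Σ ∖ {p} ≃ₘ ℝ⁴` agreeing with the inverted recentred chart `ι ∘ (e − e p)` near `p`
(`AgreesWithInvertedChartNear p Φ`).* It is `δ`-equal (`Iff.rfl`) to the Literature statement
`Literature.Geometry.Symplectic.GromovMcDuffChartForm`.

What this file records (all proofs are one-line transports of Literature theorems along that
definitional equality):

* `gromovChartForm_iff_gromovMcDuffChartForm` — the item IS the Literature chart form;
* `gromovChartForm_of_recognitionR4_relEnd` — the item follows from the single named fact
  `Literature.Geometry.Symplectic.gromov_recognitionR4_relEnd` (McDuff–Salamon 2017,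
  Rem. 4.5.2 (viii): Gromov's recognition of `(ℝ⁴, ω₀)` relative at infinity; Gromov 1985
  §0.3.C), via `gromovMcDuffChartForm_of_recognitionR4_relEnd` (the topological hypotheses
  "`Σ ∖ {p}` path connected, `π₂ = 0`" are proved there by general position). This is the
  CONDITIONAL discharge of the item: its trust base is exactly that named fact, which is also the
  crux item `GromovRecognitionRelEnd` (stmt-SmoothPoincare4-11009) of route SymplecticOrigami;
* `gromovChartForm_iff_forall_nonempty_diffeomorph_sphere` — the chart control costs nothing:
  the item is equivalent to *"a homotopy 4-sphere one of whose punctures carries a symplectic form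
  standard at infinity is diffeomorphic to `S⁴`"* (Palais' disc theorem, proved in tree, and the
  double-of-discs argument);
* `gromovChartForm_of_forall_nonempty_diffeomorph_sphere` — consequently "every homotopy
  4-sphere is diffeomorphic to `S⁴`" (in particular the problem statement `SmoothPoincare4`
  itself) implies the item: the hypothesis `hG` of `closes` is implied by its conclusion, so it
  can only be refuted by exhibiting an exotic 4-sphere (carrying, on a puncture, a symplectic
  form standard at infinity — which Gromov's theorem forbids).

The unconditional `GromovChartForm` is NOT claimed: it needs Gromov's `J`-holomorphic-curve proof
of the recognition theorem, which is not formalized (route docstring: "Provers do NOT formalise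
Gromov's J-curve proof from scratch").

## References

* D. McDuff, D. Salamon, *Introduction to Symplectic Topology*, 3rd ed., OUP 2017,
  Remark 4.5.2 (viii) [McDuffSalamon2017].
* M. Gromov, *Pseudo holomorphic curves in symplectic manifolds*, Invent. Math. 82 (1985),
  §0.3.C [Gromov1985]; D. McDuff, J. AMS 3 (1990), Thm. 1.7 [McDuff1990].
* R. S. Palais, *Extending diffeomorphisms*, Proc. AMS 11 (1960), Thm. B [Palais1960].
-/

noncomputable section

open scoped Manifold ContDiff

-- the prescribed namespace `Summit.<P>.<Sub>.…` duplicates `SmoothPoincare4` (P = Sub)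
set_option linter.dupNamespace false

namespace Summit.SmoothPoincare4.SmoothPoincare4.Theorems

open Summit.SmoothPoincare4.SmoothPoincare4.Theses.SullivanDual

/-- The route item `GromovChartForm` is, definitionally, the Literature chart form
`Literature.Geometry.Symplectic.GromovMcDuffChartForm` (hypothesis `h₁` of
`Literature.SPC4.sympcap_assembly`). [folklore] -/
theorem gromovChartForm_iff_gromovMcDuffChartForm :
    GromovChartForm ↔ Literature.Geometry.Symplectic.GromovMcDuffChartForm :=
  Iff.rfl

/-- **Conditional discharge of item stmt-SmoothPoincare4-11129.** Under the named fact
`Literature.Geometry.Symplectic.gromov_recognitionR4_relEnd` (McDuff–Salamon 2017,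
Rem. 4.5.2 (viii): a connected symplectic 4-manifold with `π₂ = 0` which is standard outside a
compact set is `(ℝ⁴, ω₀)` by a symplectomorphism equal to the given one off a compact set), the
Gromov–McDuff chart form `GromovChartForm` of route SullivanDual holds. Proof:
`Literature.Geometry.Symplectic.gromovMcDuffChartForm_of_recognitionR4_relEnd` (the topological
hypotheses on `Σ ∖ {p}` — path connected, `π₂ = 0` — are proved there by general position),
transported along `gromovChartForm_iff_gromovMcDuffChartForm`.
[cite: McDuffSalamon2017, Rem. 4.5.2 (viii)] -/
theorem gromovChartForm_of_recognitionR4_relEnd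
    (h : Literature.Geometry.Symplectic.gromov_recognitionR4_relEnd) : GromovChartForm :=
  gromovChartForm_iff_gromovMcDuffChartForm.2
    (Literature.Geometry.Symplectic.gromovMcDuffChartForm_of_recognitionR4_relEnd h)

/-- **Chart form ↔ diffeomorphism form** for the route item: `GromovChartForm` holds iff every
homotopy 4-sphere `Σ` admitting, on some puncture `Σ ∖ {p}`, a symplectic form standard near `p`
is diffeomorphic to `S⁴` (`→`: double of discs; `←`: Palais' disc theorem in chart form, proved in
`GromovMcDuffChartFormProofs.lean`). Transport of
`Literature.Geometry.Symplectic.gromovMcDuffChartForm_iff_forall_nonempty_diffeomorph_sphere`.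
[cite: Palais1960, Thm. B] -/
theorem gromovChartForm_iff_forall_nonempty_diffeomorph_sphere :
    GromovChartForm ↔
      ∀ (S : Literature.Topology.FourManifolds.HomotopySphere 4) (p : S.carrier) (ε : ℝ)
        (sf : Literature.Geometry.Kaehler.MForm (𝓡 4) (Literature.Geometry.Symplectic.punctured p)
          ℝ 2),
        Literature.Geometry.Symplectic.IsSymplecticStandardNearPoint p ε sf →
          Nonempty (S.carrier ≃ₘ⟮𝓡 4, 𝓡 4⟯ Metric.sphere (0 : EuclideanSpace ℝ (Fin 5)) 1) :=
  Literature.Geometry.Symplectic.gromovMcDuffChartForm_iff_forall_nonempty_diffeomorph_sphere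

/-- **"Every homotopy 4-sphere is standard" implies the item.** If every
`HomotopySphere 4` is diffeomorphic to `S⁴` — in particular under the problem statement
`SmoothPoincare4` itself (apply it to `S.carrier` with `S.nonempty_homotopyEquiv`) — then
`GromovChartForm` holds: Palais' disc theorem in chart form straightens the diffeomorphism near the
puncture (`gromovChartForm_iff_forall_nonempty_diffeomorph_sphere`, direction `←`); the symplectic
hypothesis is not even used. Hence the hypothesis `hG` of the deciding theorem `closes` is implied
by its conclusion: the item is refutable only by exhibiting an exotic 4-sphere (carrying, on a
puncture, a symplectic form standard at infinity). [folklore] -/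
theorem gromovChartForm_of_forall_nonempty_diffeomorph_sphere
    (h : ∀ S : Literature.Topology.FourManifolds.HomotopySphere 4,
      Nonempty (S.carrier ≃ₘ⟮𝓡 4, 𝓡 4⟯ Metric.sphere (0 : EuclideanSpace ℝ (Fin 5)) 1)) :
    GromovChartForm :=
  gromovChartForm_iff_forall_nonempty_diffeomorph_sphere.2 fun S _ _ _ _ => h S

end Summit.SmoothPoincare4.SmoothPoincare4.Theorems

end
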